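import Mathlib
import Summits.AtomisticToContinuum.HydrodynamicLimit.Theorems.RelayRaceLocalityConeLocalisationStubFlatteningDensityA
import Summits.AtomisticToContinuum.HydrodynamicLimit.Theorems.RelayRaceLocalityConeLocalisationStubFlatteningDensityB
import Summits.AtomisticToContinuum.HydrodynamicLimit.Theorems.ImplosionDichotomyHsEosLowDensity
import Literature.Analysis.FunctionSpaces.TorusDerivSizeBounds
import Literature.Analysis.FluidPDE.HardSpherePhaseSpaceProofs
import Summits.AtomisticToContinuum.HydrodynamicLimit.Theorems.RelayRaceLocalityNearConstantShortTimeHLTorusLipschitz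
import HarnessLib

/-!
# RelayRaceLocality · ConeLocalisation — stub `stub_flatteningDensity`, part C: the flattened reduced density
# `η₂ = Ψ⁻¹(ψ Ψ(ρ₁σ³) + (1 - ψ) Ψ(ρ₁(c)σ³))` and its absolute scale-`r` bounds

Support file for the crux item `stmt-AtomisticToContinuum-12504` (`ConeLocalisation`, route RelayRaceLocality of
`AtomisticToContinuum/HydrodynamicLimit`), line `zoomed-bubble-transplant`, stub `stub_flatteningDensity`
(`FlatteningDensity`, `Theorems/RelayRaceLocalityConeLocalisationLocalDefs.lean`). With the analytic excess free
energy `F` of `HsEosLowDensity` (`hsEosLowDensity_proof`), the reduced activity map `Ψ = hsActivity` IS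
`Φ_F(η) = η·exp(F η + η F′ η)` on `[0, η₀)` (part A), and part A inverts `Φ_F` smoothly on a band `[-η_b, η_b]`
(`G`, constant `D`). Here (`flatDen_core`): for a cut-off `ψ` as in `FlatteningLinear`, `σ > 0` and a smooth
`ρ₁` with `M⁻¹ ≤ ρ₁ ≤ M`, `ρ₁σ³ ≤ η_b`, `|∂^{≤3}ρ₁| ≤ M`, the function `η₂ = G ∘ A`,
`A = ψ·Φ_F(ρ₁σ³) + (1 - ψ)·Φ_F(ρ₁(c)σ³)`, is smooth, takes values in `[σ³/M, Mσ³]`, solves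
`Ψ(η₂) = ψ Ψ(ρ₁σ³) + (1 - ψ) Ψ(ρ₁(c)σ³)`, equals `ρ₁σ³` on `B(c, r)` and `ρ₁(c)σ³` off `B(c, 2r)`, and obeys
`|η₂ - ρ₁(c)σ³| ≤ Kσ³r`, `|∂η₂| ≤ Kσ³`, `|∂²η₂| ≤ Kσ³/r`, `|∂³η₂| ≤ Kσ³/r²` with `K = K(M, C_ψ)` — chain rule
bounds `flatDen_comp_bounds` (from `Torus.abs_partialDeriv{,₂,₃}_comp_le`) around the cut-off product bounds of
part B. The normalisation by `∫ η₂` (where the density floor enters) is part D (`stub_flatteningDensity`).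
-/

noncomputable section

namespace Summit.AtomisticToContinuum.HydrodynamicLimit.Theorems.ConeLocalisation

open scoped Topology ContDiff
open Filter Set MeasureTheory
open Literature.MathematicalPhysics.KineticTheory Literature.Analysis.FluidPDE
  Literature.Analysis.FunctionSpaces

/-! ### Two trivial identities -/

/-- `∂ᵢ(f + a) = ∂ᵢf` for a constant `a`. [folklore] -/
theorem flatDen_partialDeriv_add_const (f : T3 → ℝ) (a : ℝ) (i : Fin 3) :
    Torus.partialDeriv i (fun x => f x + a) = Torus.partialDeriv i f := by
  funext x
  simp only [Torus.partialDeriv, Torus.lineDeriv, deriv_add_const]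

/-- `∂ᵢ(f - a) = ∂ᵢf` for a constant `a`. [folklore] -/
theorem flatDen_partialDeriv_sub_const (f : T3 → ℝ) (a : ℝ) (i : Fin 3) :
    Torus.partialDeriv i (fun x => f x - a) = Torus.partialDeriv i f := by
  funext x
  simp only [Torus.partialDeriv, Torus.lineDeriv, deriv_sub_const]

/-! ### Chain-rule bounds with one constant -/

/-- **Composite bounds at scale `r`.** If `φ` is smooth on an open `V` containing the range of the smooth
`w : 𝕋³ → ℝ` with `|φ′|, |φ″|, |φ‴| ≤ D` on the range, and `|∂w| ≤ m`, `|∂²w| ≤ m/r`, `|∂³w| ≤ m/r²`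
(`0 < r ≤ 1`), then `|∂(φ∘w)| ≤ D(m² + 3m + 1)m`, `|∂²(φ∘w)| ≤ D(m² + 3m + 1)m/r`,
`|∂³(φ∘w)| ≤ D(m² + 3m + 1)m/r²`. [folklore] -/
theorem flatDen_comp_bounds {φ : ℝ → ℝ} {V : Set ℝ} {w : T3 → ℝ} {D m r : ℝ}
    (hφ : ContDiffOn ℝ ∞ φ V) (hV : IsOpen V) (hw : Torus.IsSmooth w) (hwV : ∀ x, w x ∈ V)
    (hD : 0 ≤ D) (hm : 0 ≤ m) (hr : 0 < r) (hr1 : r ≤ 1)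
    (hC : ∀ x, |deriv φ (w x)| ≤ D ∧ |deriv (deriv φ) (w x)| ≤ D ∧ |deriv (deriv (deriv φ)) (w x)| ≤ D)
    (hwd : ∀ x, ∀ i j k : Fin 3, |Torus.partialDeriv i w x| ≤ m ∧
      |Torus.partialDeriv i (Torus.partialDeriv j w) x| ≤ m / r ∧
      |Torus.partialDeriv i (Torus.partialDeriv j (Torus.partialDeriv k w)) x| ≤ m / r ^ 2) :
    ∀ x, ∀ i j k : Fin 3, |Torus.partialDeriv i (fun z => φ (w z)) x| ≤ D * (m ^ 2 + 3 * m + 1) * m ∧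
      |Torus.partialDeriv i (Torus.partialDeriv j (fun z => φ (w z))) x| ≤
        D * (m ^ 2 + 3 * m + 1) * m / r ∧
      |Torus.partialDeriv i (Torus.partialDeriv j (Torus.partialDeriv k (fun z => φ (w z)))) x| ≤
        D * (m ^ 2 + 3 * m + 1) * m / r ^ 2 := by
  intro x i j k
  have hC₁ : ∀ y, |deriv φ (w y)| ≤ D := fun y => (hC y).1
  have hC₂ : ∀ y, |deriv (deriv φ) (w y)| ≤ D := fun y => (hC y).2.1
  have hC₃ : ∀ y, |deriv (deriv (deriv φ)) (w y)| ≤ D := fun y => (hC y).2.2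
  have e1 := Torus.abs_partialDeriv_comp_le hφ hV hw hwV hC₁ i x
  have e2 := Torus.abs_partialDeriv₂_comp_le hφ hV hw hwV hC₁ hC₂ j i x
  have e3 := Torus.abs_partialDeriv₃_comp_le hφ hV hw hwV hC₁ hC₂ hC₃ k j i x
  -- the scale factor `u = 1/r ≥ 1`
  set u : ℝ := 1 / r with hu
  have hu1 : 1 ≤ u := by rw [hu, le_div_iff₀ hr]; linarith
  have hu0 : 0 ≤ u := zero_le_one.trans hu1
  have huu : u ≤ u ^ 2 := by nlinarith
  have a1 : ∀ l, |Torus.partialDeriv l w x| ≤ m := fun l => (hwd x l l l).1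
  have a2 : ∀ l l', |Torus.partialDeriv l (Torus.partialDeriv l' w) x| ≤ m * u := fun l l' => by
    rw [hu, ← div_eq_mul_one_div]; exact (hwd x l l' l').2.1
  have a3 : |Torus.partialDeriv i (Torus.partialDeriv j (Torus.partialDeriv k w)) x| ≤ m * u ^ 2 := by
    rw [hu, one_div_pow, ← div_eq_mul_one_div]; exact (hwd x i j k).2.2
  have n0 : ∀ l, 0 ≤ |Torus.partialDeriv l w x| := fun l => abs_nonneg _
  have q2 : D * (m ^ 2 + 3 * m + 1) * m / r = D * (m ^ 2 + 3 * m + 1) * m * u := by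
    rw [hu, ← div_eq_mul_one_div]
  have q3 : D * (m ^ 2 + 3 * m + 1) * m / r ^ 2 = D * (m ^ 2 + 3 * m + 1) * m * u ^ 2 := by
    rw [hu, one_div_pow, ← div_eq_mul_one_div]
  have f0 : 0 ≤ D * m := mul_nonneg hD hm
  have f1 : 0 ≤ D * m ^ 2 * (u - 1) := mul_nonneg (by positivity) (by linarith)
  have f2 : 0 ≤ D * m ^ 3 * (u ^ 2 - 1) := mul_nonneg (by positivity) (by nlinarith)
  have f3 : 0 ≤ D * m ^ 2 * (u ^ 2 - u) := mul_nonneg (by positivity) (by linarith)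
  have f4 : 0 ≤ D * m * (u - 1) := mul_nonneg f0 (by linarith)
  refine ⟨e1.trans ?_, e2.trans ?_, e3.trans ?_⟩
  · have p : D * |Torus.partialDeriv i w x| ≤ D * m := mul_le_mul_of_nonneg_left (a1 i) hD
    nlinarith [mul_nonneg f0 hm, mul_nonneg (mul_nonneg f0 hm) hm]
  · have p1 : |Torus.partialDeriv i w x| * |Torus.partialDeriv j w x| ≤ m * m :=
      mul_le_mul (a1 i) (a1 j) (n0 j) hm
    have p : D * (|Torus.partialDeriv i w x| * |Torus.partialDeriv j w x|) +
        D * |Torus.partialDeriv i (Torus.partialDeriv j w) x| ≤ D * (m * m) + D * (m * u) :=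
      add_le_add (mul_le_mul_of_nonneg_left p1 hD) (mul_le_mul_of_nonneg_left (a2 i j) hD)
    rw [q2]
    refine p.trans ?_
    nlinarith [mul_nonneg (mul_nonneg f0 hm) hu0, mul_nonneg (mul_nonneg (mul_nonneg f0 hm) hm) hu0]
  · have p1 : |Torus.partialDeriv i w x| * |Torus.partialDeriv j w x| * |Torus.partialDeriv k w x| ≤
        m * m * m := mul_le_mul (mul_le_mul (a1 i) (a1 j) (n0 j) hm) (a1 k) (n0 k) (mul_nonneg hm hm)
    have p2 : |Torus.partialDeriv i (Torus.partialDeriv j w) x| * |Torus.partialDeriv k w x| +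
        |Torus.partialDeriv j w x| * |Torus.partialDeriv i (Torus.partialDeriv k w) x| +
        |Torus.partialDeriv i w x| * |Torus.partialDeriv j (Torus.partialDeriv k w) x| ≤
        m * u * m + m * (m * u) + m * (m * u) :=
      add_le_add (add_le_add (mul_le_mul (a2 i j) (a1 k) (n0 k) (mul_nonneg hm hu0))
        (mul_le_mul (a1 j) (a2 i k) (abs_nonneg _) hm)) (mul_le_mul (a1 i) (a2 j k) (abs_nonneg _) hm)
    have p : D * (|Torus.partialDeriv i w x| * |Torus.partialDeriv j w x| * |Torus.partialDeriv k w x|) +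
        D * (|Torus.partialDeriv i (Torus.partialDeriv j w) x| * |Torus.partialDeriv k w x| +
          |Torus.partialDeriv j w x| * |Torus.partialDeriv i (Torus.partialDeriv k w) x| +
          |Torus.partialDeriv i w x| * |Torus.partialDeriv j (Torus.partialDeriv k w) x|) +
        D * |Torus.partialDeriv i (Torus.partialDeriv j (Torus.partialDeriv k w)) x| ≤
        D * (m * m * m) + D * (m * u * m + m * (m * u) + m * (m * u)) + D * (m * u ^ 2) :=
      add_le_add (add_le_add (mul_le_mul_of_nonneg_left p1 hD) (mul_le_mul_of_nonneg_left p2 hD))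
        (mul_le_mul_of_nonneg_left a3 hD)
    rw [q3]
    refine p.trans ?_
    nlinarith [f2, f3]

/-! ### The flattened reduced density -/

/-- **The flattened reduced density `η₂ = Ψ⁻¹(ψ Ψ(ρ₁σ³) + (1 - ψ) Ψ(ρ₁(c)σ³))` and its absolute bounds.**
There is a band `η_F > 0` and, for all `M, C_ψ > 0`, a constant `K` such that for every cut-off `ψ` as in
`FlatteningLinear` at scale `0 < r ≤ 1/16`, every `σ > 0` and every smooth `ρ₁` with `M⁻¹ ≤ ρ₁ ≤ M`,
`ρ₁σ³ ≤ η_F`, `|∂^{≤3}ρ₁| ≤ M`, there is a smooth `η₂ : 𝕋³ → [σ³/M, Mσ³]` solving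
`Ψ(η₂) = ψ Ψ(ρ₁σ³) + (1 - ψ) Ψ(ρ₁(c)σ³)`, equal to `ρ₁σ³` on `B(c, r)` and to `ρ₁(c)σ³` off `B(c, 2r)`, with
`|η₂ - ρ₁(c)σ³| ≤ Kσ³r`, `|∂η₂| ≤ Kσ³`, `|∂²η₂| ≤ Kσ³/r`, `|∂³η₂| ≤ Kσ³/r²`. [folklore] -/
theorem flatDen_core : ∃ ηF : ℝ, 0 < ηF ∧ ∀ M : ℝ, 0 < M → ∀ Cψ : ℝ, 0 < Cψ → ∃ K : ℝ, 0 < K ∧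
    ∀ r : ℝ, 0 < r → r ≤ 1 / 16 → ∀ c : T3, ∀ ψ : T3 → ℝ, Torus.IsSmooth ψ → (∀ x, 0 ≤ ψ x ∧ ψ x ≤ 1) →
    (∀ x, Torus.euclidDist x c < r → ψ x = 1) → (∀ x, 2 * r ≤ Torus.euclidDist x c → ψ x = 0) →
    (∀ x, ∀ i j k : Fin 3, |Torus.partialDeriv i ψ x| ≤ Cψ / r ∧
      |Torus.partialDeriv i (Torus.partialDeriv j ψ) x| ≤ Cψ / r ^ 2 ∧
      |Torus.partialDeriv i (Torus.partialDeriv j (Torus.partialDeriv k ψ)) x| ≤ Cψ / r ^ 3) →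
    ∀ σ : ℝ, 0 < σ → ∀ ρ₁ : T3 → ℝ, Torus.IsSmooth ρ₁ →
    (∀ x, ρ₁ x * σ ^ 3 ≤ ηF ∧ M⁻¹ ≤ ρ₁ x ∧ ρ₁ x ≤ M ∧ ∀ i j k : Fin 3,
      |Torus.partialDeriv i ρ₁ x| ≤ M ∧ |Torus.partialDeriv i (Torus.partialDeriv j ρ₁) x| ≤ M ∧
      |Torus.partialDeriv i (Torus.partialDeriv j (Torus.partialDeriv k ρ₁)) x| ≤ M) →
    ∃ η₂ : T3 → ℝ, Torus.IsSmooth η₂ ∧ (∀ x, M⁻¹ * σ ^ 3 ≤ η₂ x ∧ η₂ x ≤ M * σ ^ 3) ∧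
      (∀ x, hsActivity (η₂ x) = ψ x * hsActivity (ρ₁ x * σ ^ 3) + (1 - ψ x) * hsActivity (ρ₁ c * σ ^ 3)) ∧
      (∀ x, Torus.euclidDist x c < r → η₂ x = ρ₁ x * σ ^ 3) ∧
      (∀ x, 2 * r ≤ Torus.euclidDist x c → η₂ x = ρ₁ c * σ ^ 3) ∧
      (∀ x, |η₂ x - ρ₁ c * σ ^ 3| ≤ K * σ ^ 3 * r) ∧
      (∀ x, ∀ i j k : Fin 3, |Torus.partialDeriv i η₂ x| ≤ K * σ ^ 3 ∧
        |Torus.partialDeriv i (Torus.partialDeriv j η₂) x| ≤ K * σ ^ 3 / r ∧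
        |Torus.partialDeriv i (Torus.partialDeriv j (Torus.partialDeriv k η₂)) x| ≤ K * σ ^ 3 / r ^ 2) := by
  obtain ⟨η₀, hη₀, F, hFa, hEq, hF0, -, -⟩ := hsEosLowDensity_proof
  -- the analytic activity map `Φ = Φ_F` and its inversion package (part A)
  obtain ⟨Φ, hΦdef⟩ : ∃ Φ : ℝ → ℝ, Φ = fun η => η * Real.exp (F η + η * deriv F η) := ⟨_, rfl⟩
  have hV : IsOpen (Ioo (-η₀) η₀) := isOpen_Ioo
  have h0V : (0 : ℝ) ∈ Ioo (-η₀) η₀ := ⟨by linarith, hη₀⟩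
  have hΦcd : ContDiffOn ℝ ∞ Φ (Ioo (-η₀) η₀) := by rw [hΦdef]; exact flatDen_phiF_contDiffOn hFa
  have hΦ'0 : 0 < deriv Φ 0 := by rw [hΦdef, flatDen_deriv_phiF_zero hη₀ hFa hF0]; exact one_pos
  obtain ⟨ηb, hηb, hbV, hmono, D, hD, hΦbd, G, W, hW, hGcd, hKW, hGm, hGΦ, hΦG, hGbd, hGlip⟩ :=
    flatDen_inverse_package hV h0V hΦcd hΦ'0
  have hΨ : ∀ η ∈ Ico 0 η₀, hsActivity η = Φ η := by rw [hΦdef]; exact flatDen_hsActivity_eq_phiF hEq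
  have hbη₀ : ηb < η₀ := (hbV ⟨by linarith, le_rfl⟩).2
  have hl : (-ηb) ∈ Icc (-ηb) ηb := ⟨le_rfl, by linarith⟩
  have hh : ηb ∈ Icc (-ηb) ηb := ⟨by linarith, le_rfl⟩
  refine ⟨ηb, hηb, fun M hM Cψ hCψ => ?_⟩
  -- constants (functions of `M`, `C_ψ`, `D`, `η_b` only)
  have hD0 : 0 ≤ D := zero_le_one.trans hD
  set Q : ℝ := M ^ 2 * ηb with hQ
  set R : ℝ := D * (Q ^ 2 + 3 * Q + 1) with hR
  set P : ℝ := (1 + 12 * Cψ) * R * M with hP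
  set Kb : ℝ := P * (M * ηb) with hKb
  set K : ℝ := 6 * D * R * M + D * (Kb ^ 2 + 3 * Kb + 1) * P with hK
  have hQ0 : 0 ≤ Q := by positivity
  have hR1 : D ≤ R := by
    rw [hR]; nlinarith only [mul_nonneg hD0 hQ0, mul_nonneg hD0 (sq_nonneg Q)]
  have hR0 : 0 ≤ R := hD0.trans hR1
  have hP0 : 0 ≤ P := by positivity
  have hKb0 : 0 ≤ Kb := by positivity
  have hKP0 : 0 ≤ D * (Kb ^ 2 + 3 * Kb + 1) * P := by positivity
  have hDpos : 0 < D := by linarith only [hD]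
  have hRpos : 0 < R := by linarith only [hD, hR1]
  have hK0 : 0 < K := by
    have h1 : 0 < 6 * D * R * M := by positivity
    rw [hK]; linarith only [h1, hKP0]
  refine ⟨K, hK0, fun r hr hr16 c ψ hψs hψ01 hψ1 hψ0 hψd σ hσ ρ₁ hρs hρ => ?_⟩
  have hr1 : r ≤ 1 := by linarith only [hr16]
  set s3 : ℝ := σ ^ 3 with hs3
  have hs3p : 0 < s3 := pow_pos hσ 3
  have hMi : 0 < M⁻¹ := inv_pos.2 hM
  -- the inner function `w = σ³ ρ₁`
  obtain ⟨w, hw⟩ : ∃ w : T3 → ℝ, w = fun x => s3 * ρ₁ x := ⟨_, rfl⟩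
  have hwx : ∀ x, w x = s3 * ρ₁ x := fun x => by rw [hw]
  have hwlo : ∀ x, M⁻¹ * s3 ≤ w x := fun x => by
    rw [hwx, mul_comm s3]; exact mul_le_mul_of_nonneg_right (hρ x).2.1 hs3p.le
  have hwhi : ∀ x, w x ≤ M * s3 := fun x => by
    rw [hwx, mul_comm M]; exact mul_le_mul_of_nonneg_left (hρ x).2.2.1 hs3p.le
  have hwb : ∀ x, w x ≤ ηb := fun x => by rw [hwx, mul_comm]; exact (hρ x).1
  have hwpos : ∀ x, 0 < w x := fun x => (mul_pos hMi hs3p).trans_le (hwlo x)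
  have hwI : ∀ x, w x ∈ Icc (-ηb) ηb := fun x => ⟨by linarith only [hwpos x, hηb], hwb x⟩
  have hwV : ∀ x, w x ∈ Ioo (-η₀) η₀ := fun x =>
    ⟨by linarith only [hwpos x, hη₀], (hwb x).trans_lt hbη₀⟩
  have hs3M : s3 ≤ M * ηb := by
    have h1 : M⁻¹ * s3 ≤ ηb := (hwlo c).trans (hwb c)
    calc s3 = M * (M⁻¹ * s3) := by field_simp
      _ ≤ M * ηb := mul_le_mul_of_nonneg_left h1 hM.le
  have hmQ : M * s3 ≤ Q := by rw [hQ, sq, mul_assoc]; exact mul_le_mul_of_nonneg_left hs3M hM.le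
  have hws : Torus.IsSmooth w := by
    rw [hw]; exact (ContDiff.mul contDiff_const hρs : Torus.IsSmooth fun x => s3 * ρ₁ x)
  have hwd : ∀ x, ∀ i j k : Fin 3, |Torus.partialDeriv i w x| ≤ M * s3 ∧
      |Torus.partialDeriv i (Torus.partialDeriv j w) x| ≤ M * s3 / 1 ∧
      |Torus.partialDeriv i (Torus.partialDeriv j (Torus.partialDeriv k w)) x| ≤ M * s3 / 1 ^ 2 := by
    intro x i j k
    obtain ⟨d1, d2, d3⟩ := (hρ x).2.2.2 i j k
    have e1 := (Torus.partialDeriv₃_const_mul hρs s3 i i i x).1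
    have e2 := (Torus.partialDeriv₃_const_mul hρs s3 j i i x).2.1
    have e3 := (Torus.partialDeriv₃_const_mul hρs s3 k j i x).2.2
    rw [← hw] at e1 e2 e3
    refine ⟨?_, ?_, ?_⟩
    · rw [e1, abs_mul, abs_of_pos hs3p, mul_comm]; exact mul_le_mul_of_nonneg_right d1 hs3p.le
    · rw [e2, div_one, abs_mul, abs_of_pos hs3p, mul_comm]; exact mul_le_mul_of_nonneg_right d2 hs3p.le
    · rw [e3, one_pow, div_one, abs_mul, abs_of_pos hs3p, mul_comm]
      exact mul_le_mul_of_nonneg_right d3 hs3p.le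
  -- the smooth field `f = Φ ∘ w` and its derivative bounds `L = R·Mσ³`
  obtain ⟨f, hf⟩ : ∃ f : T3 → ℝ, f = fun x => Φ (w x) := ⟨_, rfl⟩
  have hfx : ∀ x, f x = Φ (w x) := fun x => by rw [hf]
  have hfs : Torus.IsSmooth f := by rw [hf]; exact Torus.IsSmooth.comp_of_contDiffOn hΦcd hws hwV
  have hfbd := flatDen_comp_bounds hΦcd hV hws hwV hD0 (by positivity : (0 : ℝ) ≤ M * s3) one_pos le_rfl
    (fun x => hΦbd (w x) (hwI x)) hwd
  rw [← hf] at hfbd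
  set L : ℝ := R * (M * s3) with hL
  have hL0 : 0 ≤ L := by positivity
  have hLbd : D * ((M * s3) ^ 2 + 3 * (M * s3) + 1) * (M * s3) ≤ L := by
    rw [hL, hR]
    have h2 : 0 ≤ M * s3 := by positivity
    have h1 : (M * s3) ^ 2 + 3 * (M * s3) + 1 ≤ Q ^ 2 + 3 * Q + 1 := by
      nlinarith only [hmQ, h2, hQ0, mul_le_mul hmQ hmQ h2 hQ0]
    exact mul_le_mul_of_nonneg_right (mul_le_mul_of_nonneg_left h1 hD0) h2
  have hfd : ∀ x, ∀ i j k : Fin 3, |Torus.partialDeriv i f x| ≤ L ∧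
      |Torus.partialDeriv i (Torus.partialDeriv j f) x| ≤ L ∧
      |Torus.partialDeriv i (Torus.partialDeriv j (Torus.partialDeriv k f)) x| ≤ L := fun x i j k => by
    obtain ⟨b1, b2, b3⟩ := hfbd x i j k
    rw [div_one] at b2; rw [one_pow, div_one] at b3
    exact ⟨b1.trans hLbd, b2.trans hLbd, b3.trans hLbd⟩
  -- the cut-off product `ψ·(f - f c)` (part B) and the flattened activity `A`
  obtain ⟨g, hg⟩ : ∃ g : T3 → ℝ, g = fun x => f x - f c := ⟨_, rfl⟩
  have hgx : ∀ x, g x = f x - f c := fun x => by rw [hg]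
  have hgs : Torus.IsSmooth g := by
    rw [hg]; exact (ContDiff.sub hfs contDiff_const : Torus.IsSmooth fun x => f x - f c)
  have hgd : ∀ x, ∀ i j k : Fin 3, |Torus.partialDeriv i g x| ≤ L ∧
      |Torus.partialDeriv i (Torus.partialDeriv j g) x| ≤ L ∧
      |Torus.partialDeriv i (Torus.partialDeriv j (Torus.partialDeriv k g)) x| ≤ L := fun x i j k => by
    simp only [hg, flatDen_partialDeriv_sub_const]; exact hfd x i j k
  obtain ⟨hB0, hBd⟩ := flatDen_cutoff_product_bounds hr hr1 hCψ.le hL0 hψs hψ01 hψ0 hψd hgs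
    (by rw [hgx, sub_self]) hgd
  obtain ⟨A, hA⟩ : ∃ A : T3 → ℝ, A = fun x => ψ x * g x + f c := ⟨_, rfl⟩
  have hAs : Torus.IsSmooth A := by
    rw [hA]; exact (ContDiff.add (ContDiff.mul hψs hgs) contDiff_const : Torus.IsSmooth fun x => ψ x * g x + f c)
  have hPL : (1 + 12 * Cψ) * L = P * s3 := by rw [hP, hL]; ring
  have hAd : ∀ x, ∀ i j k : Fin 3, |Torus.partialDeriv i A x| ≤ P * s3 ∧
      |Torus.partialDeriv i (Torus.partialDeriv j A) x| ≤ P * s3 / r ∧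
      |Torus.partialDeriv i (Torus.partialDeriv j (Torus.partialDeriv k A)) x| ≤ P * s3 / r ^ 2 := by
    intro x i j k
    simp only [hA, flatDen_partialDeriv_add_const]
    rw [← hPL]
    exact hBd x i j k
  -- ranges: `f`, `A` take values in `[Φ(-η_b), Φ(η_b)] ⊆ W`
  have hfK : ∀ x, f x ∈ Icc (Φ (-ηb)) (Φ ηb) := fun x => by
    rw [hfx]; exact ⟨hmono.monotoneOn hl (hwI x) (hwI x).1, hmono.monotoneOn (hwI x) hh (hwI x).2⟩
  have hAconv : ∀ x, A x = ψ x * f x + (1 - ψ x) * f c := fun x => by simp only [hA, hgx]; ring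
  have hAbetween : ∀ x, min (f x) (f c) ≤ A x ∧ A x ≤ max (f x) (f c) := by
    intro x
    obtain ⟨h0, h1⟩ := hψ01 x
    rw [hAconv x]
    constructor
    · nlinarith only [mul_nonneg h0 (sub_nonneg.2 (min_le_left (f x) (f c))),
        mul_nonneg (sub_nonneg.2 h1) (sub_nonneg.2 (min_le_right (f x) (f c)))]
    · nlinarith only [mul_nonneg h0 (sub_nonneg.2 (le_max_left (f x) (f c))),
        mul_nonneg (sub_nonneg.2 h1) (sub_nonneg.2 (le_max_right (f x) (f c)))]
  have hAK : ∀ x, A x ∈ Icc (Φ (-ηb)) (Φ ηb) := fun x =>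
    ⟨(le_min (hfK x).1 (hfK c).1).trans (hAbetween x).1, (hAbetween x).2.trans (max_le (hfK x).2 (hfK c).2)⟩
  have hAW : ∀ x, A x ∈ W := fun x => hKW (hAK x)
  -- the flattened density `η₂ = G ∘ A`
  obtain ⟨η₂, hη₂⟩ : ∃ η₂ : T3 → ℝ, η₂ = fun x => G (A x) := ⟨_, rfl⟩
  have hη₂x : ∀ x, η₂ x = G (A x) := fun x => by rw [hη₂]
  have hη₂s : Torus.IsSmooth η₂ := by rw [hη₂]; exact Torus.IsSmooth.comp_of_contDiffOn hGcd hAs hAW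
  have hGf : ∀ x, G (f x) = w x := fun x => by rw [hfx]; exact hGΦ (w x) (hwI x)
  have hη₂between : ∀ x, min (w x) (w c) ≤ η₂ x ∧ η₂ x ≤ max (w x) (w c) := by
    intro x
    have h1 := hGm (hAbetween x).1
    have h2 := hGm (hAbetween x).2
    rw [hGm.map_min, hGf, hGf] at h1
    rw [hGm.map_max, hGf, hGf] at h2
    rw [hη₂x]; exact ⟨h1, h2⟩
  have hη₂band : ∀ x, M⁻¹ * s3 ≤ η₂ x ∧ η₂ x ≤ M * s3 := fun x =>
    ⟨(le_min (hwlo x) (hwlo c)).trans (hη₂between x).1, (hη₂between x).2.trans (max_le (hwhi x) (hwhi c))⟩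
  -- derivative bounds of `η₂`
  have hη₂d := flatDen_comp_bounds hGcd hW hAs hAW hD0 (by positivity : (0 : ℝ) ≤ P * s3) hr hr1
    (fun x => hGbd (A x) (hAK x)) hAd
  rw [← hη₂] at hη₂d
  have hPs : P * s3 ≤ Kb := by rw [hKb]; exact mul_le_mul_of_nonneg_left hs3M hP0
  have hKη : D * ((P * s3) ^ 2 + 3 * (P * s3) + 1) * (P * s3) ≤ K * s3 := by
    have h2 : 0 ≤ P * s3 := by positivity
    have h1 : (P * s3) ^ 2 + 3 * (P * s3) + 1 ≤ Kb ^ 2 + 3 * Kb + 1 := by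
      nlinarith only [hPs, h2, hKb0, mul_le_mul hPs hPs h2 hKb0]
    have h3 : D * (Kb ^ 2 + 3 * Kb + 1) * P * s3 ≤ K * s3 := by
      have h4 : 0 ≤ 6 * D * R * M * s3 := by positivity
      rw [hK]; nlinarith only [h4]
    calc D * ((P * s3) ^ 2 + 3 * (P * s3) + 1) * (P * s3) ≤ D * (Kb ^ 2 + 3 * Kb + 1) * (P * s3) :=
          mul_le_mul_of_nonneg_right (mul_le_mul_of_nonneg_left h1 hD0) h2
      _ = D * (Kb ^ 2 + 3 * Kb + 1) * P * s3 := by ring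
      _ ≤ K * s3 := h3
  have hK6 : 6 * L * r * D ≤ K * s3 * r := by
    have h1 : 6 * L * r * D = (6 * D * R * M * s3) * r := by rw [hL]; ring
    have h2 : 6 * D * R * M * s3 ≤ K * s3 := by
      have h4 := mul_nonneg hKP0 hs3p.le
      rw [hK]; nlinarith only [h4]
    rw [h1]; exact mul_le_mul_of_nonneg_right h2 hr.le
  refine ⟨η₂, hη₂s, hη₂band, fun x => ?_, fun x hx => ?_, fun x hx => ?_, fun x => ?_, fun x i j k => ?_⟩
  · -- the activity identity
    have hη₂I : η₂ x ∈ Ico 0 η₀ := ⟨(mul_pos hMi hs3p).le.trans (hη₂band x).1, by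
      rw [hη₂x]; exact (hΦG (A x) (hAK x)).2.2.trans_lt hbη₀⟩
    have hwx' : ρ₁ x * σ ^ 3 = w x := by rw [hwx, hs3]; ring
    have hwc' : ρ₁ c * σ ^ 3 = w c := by rw [hwx, hs3]; ring
    rw [hΨ _ hη₂I, hwx', hwc', hΨ _ ⟨(hwpos x).le, (hwV x).2⟩, hΨ _ ⟨(hwpos c).le, (hwV c).2⟩, hη₂x,
      (hΦG (A x) (hAK x)).1, hAconv x, hfx, hfx]
  · -- plateau: `ψ = 1`
    have : A x = f x := by rw [hAconv x, hψ1 x hx]; ring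
    rw [hη₂x, this, hGf x, hwx, hs3]; ring
  · -- off the ball: `ψ = 0`
    have : A x = f c := by rw [hAconv x, hψ0 x hx]; ring
    rw [hη₂x, this, hGf c, hwx, hs3]; ring
  · -- deviation from the far value
    have hwc' : ρ₁ c * σ ^ 3 = G (f c) := by rw [hGf c, hwx, hs3]; ring
    rw [hwc', hη₂x]
    have h1 := hGlip (A x) (hAK x) (f c) (hfK c)
    have h2 : |A x - f c| ≤ 6 * L * r := by
      have : A x - f c = ψ x * g x := by simp only [hA]; ring
      rw [this]; exact hB0 x
    calc |G (A x) - G (f c)| ≤ D * |A x - f c| := h1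
      _ ≤ D * (6 * L * r) := mul_le_mul_of_nonneg_left h2 hD0
      _ = 6 * L * r * D := by ring
      _ ≤ K * s3 * r := hK6
  · -- derivative bounds
    obtain ⟨b1, b2, b3⟩ := hη₂d x i j k
    exact ⟨b1.trans hKη, b2.trans (div_le_div_of_nonneg_right hKη hr.le),
      b3.trans (div_le_div_of_nonneg_right hKη (by positivity))⟩

end Summit.AtomisticToContinuum.HydrodynamicLimit.Theorems.ConeLocalisation

end
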